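import Literature.Analysis.FluidPDE.SereginSverakProbeCutoff
import Literature.Analysis.FluidPDE.ClassicalLocalEnergyWindow
import HarnessLib

/-!
# The probe-smoothed scaled energy of a classical solution cannot jump up over a time window

Analysis/FluidPDE proof file (theorems only; no definitions, no named facts) on the discharge
path of the named fact `Literature.Analysis.FluidPDE.seregin_sverak_2002`
(`SereginSverakPressure.lean`; G. Seregin, V. Šverák, Arch. Ration. Mech. Anal. **163** (2002)
65–86). It assembles

* the truncated probe test function and its scale-invariant bounds
  (`SereginSverakProbeCutoff.lean`),
* the window bound for the localised energy of a classical solution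
  (`ClassicalLocalEnergyWindow.lean`),
* and the exact power-law tail of the probe (`P̄(σ) = P̄(1) σ^{-3/2}` for `σ ≥ 1`,
  `SereginSverakPressureMonotone.probe_sq_mul_cube_eq`),

into the statement that the probe energy `F(r; x₀, t) = ∫ |u(t)|² r⁻¹ P̄(|x - x₀|²/r²)` of
`SereginSverakPressureMonotone.lean` / `SereginSverakOneScaleSmallness.lean` satisfies, between
two times `t₀ ≤ t₁` of a window `[t₀, t₁] ⊆ S`,

  `F(r; x₀, t₁) − F(r; x₀, t₀) ≤ L⁻² F(Lr; x₀, t₁) + ν (C/r³) a (t₁ − t₀) + (C/r²)(m₃ + 2 m_{pu})`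

(`SereginSverak2002.probeEnergy_sub_le_window`), where `a`, `m₃`, `m_{pu}` are the three window
quantities of `ClassicalLocalEnergyWindow.lean` on `(t₀, t₁) × B(x₀, 3Lr)` and `L ≥ 1` is the
truncation parameter. The tail term comes from the pointwise identity
`r⁻¹ P̄(|y|²/r²) = L⁻² (Lr)⁻¹ P̄(|y|²/(Lr)²)` for `|y| ≥ Lr` (`inv_mul_probe_eq_of_le`), which
gives `0 ≤ F(r) − F_L(r) ≤ L⁻² F(Lr)` for the truncated probe energy `F_L`
(`probeEnergy_sub_truncated_nonneg`, `probeEnergy_sub_truncated_le`) — no dyadic decomposition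
is needed. Finally, the elementary real-variable lemma
`SereginSverak2002.le_of_frequently_gt_of_window` converts "`g > δ` at times arbitrarily close
to `T`" plus "`g(t₀) ≥ g(t₁) − ε` on short windows" into "`g ≥ δ − ε` on a final window" — the
form in which largeness of the scaled energy at a singular point (the contrapositive of Lemma
3.3, `SereginSverakOneScaleSmallness.lean`) propagates to whole parabolic windows.

## References

* G. Seregin, V. Šverák, Arch. Ration. Mech. Anal. 163 (2002), 65–86 (the result served).
  [SereginSverak2002]
* L. Caffarelli, R. Kohn, L. Nirenberg, CPAM 35 (1982), §2, (2.5). [CaffarelliKohnNirenberg1982]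
-/

noncomputable section

open MeasureTheory Set Function Filter Metric Real
open _root_.Topology
open scoped NNReal ENNReal RealInnerProductSpace ContDiff Laplacian

namespace Literature.Analysis.FluidPDE

namespace SereginSverak2002

variable {P Pb : ℝ → ℝ}

/-! ### The power-law tail of the probe -/

/-- **Scaling of the probe tail**: for `|y| ≥ Lr` (`L ≥ 1`, `r > 0`),
`r⁻¹ P̄(|y|²/r²) = L⁻² · (Lr)⁻¹ P̄(|y|²/(Lr)²)`, because `P̄(σ)² σ³` is constant on `σ ≥ 1`
and `P̄ > 0`. [folklore] -/
theorem inv_mul_probe_eq_of_le (hPb : Differentiable ℝ Pb)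
    (hode : ∀ σ, Pb σ + 2 / 3 * σ * deriv Pb σ = P σ) (hP0 : ∀ σ, 1 ≤ σ → P σ = 0)
    (hPbpos : ∀ σ, 0 < Pb σ) {L r : ℝ} (hL : 1 ≤ L) (hr : 0 < r)
    {y : EuclideanSpace ℝ (Fin 3)} (hy : L * r ≤ ‖y‖) :
    r⁻¹ * Pb (‖y‖ ^ 2 / r ^ 2) = (L ^ 2)⁻¹ * ((L * r)⁻¹ * Pb (‖y‖ ^ 2 / (L * r) ^ 2)) := by
  have hL0 : 0 < L := by linarith
  have hLr : 0 < L * r := mul_pos hL0 hr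
  set σ₁ : ℝ := ‖y‖ ^ 2 / r ^ 2 with hσ₁
  set σ₂ : ℝ := ‖y‖ ^ 2 / (L * r) ^ 2 with hσ₂
  have hσ₂1 : 1 ≤ σ₂ := by
    rw [hσ₂, le_div_iff₀ (by positivity)]
    nlinarith [hy, hLr]
  have hrel : σ₁ = L ^ 2 * σ₂ := by
    rw [hσ₁, hσ₂]; field_simp
  have hσ₁1 : 1 ≤ σ₁ := by
    rw [hrel]; nlinarith [hσ₂1]
  have h1 := probe_sq_mul_cube_eq hPb hode hP0 hσ₁1
  have h2 := probe_sq_mul_cube_eq hPb hode hP0 hσ₂1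
  -- `(P̄(σ₁) L³)² = P̄(σ₂)²`
  have hsq : (Pb σ₁ * L ^ 3) ^ 2 = Pb σ₂ ^ 2 := by
    have hσ₂0 : σ₂ ≠ 0 := by positivity
    have e : Pb σ₁ ^ 2 * (L ^ 2 * σ₂) ^ 3 = Pb σ₂ ^ 2 * σ₂ ^ 3 := by rw [← hrel, h1, h2]
    have e' : (Pb σ₁ * L ^ 3) ^ 2 * σ₂ ^ 3 = Pb σ₂ ^ 2 * σ₂ ^ 3 := by
      rw [← e]; ring
    exact mul_right_cancel₀ (pow_ne_zero 3 hσ₂0) e'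
  have heq : Pb σ₁ * L ^ 3 = Pb σ₂ := by
    have ha : 0 ≤ Pb σ₁ * L ^ 3 := by have := hPbpos σ₁; positivity
    have hb : 0 ≤ Pb σ₂ := (hPbpos σ₂).le
    exact (sq_eq_sq₀ ha hb).1 hsq
  have hL3 : (L ^ 3)⁻¹ * L ^ 3 = 1 := inv_mul_cancel₀ (pow_ne_zero 3 hL0.ne')
  calc r⁻¹ * Pb σ₁ = r⁻¹ * ((L ^ 3)⁻¹ * L ^ 3) * Pb σ₁ := by rw [hL3, mul_one]
    _ = r⁻¹ * (L ^ 3)⁻¹ * (Pb σ₁ * L ^ 3) := by ring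
    _ = r⁻¹ * (L ^ 3)⁻¹ * Pb σ₂ := by rw [heq]
    _ = (L ^ 2)⁻¹ * ((L * r)⁻¹ * Pb σ₂) := by ring

/-! ### The truncated probe energy versus the probe energy -/

/-- Integrability of `|w|²` against a bounded measurable weight. [folklore] -/
theorem integrable_norm_sq_mul_of_abs_le {w : EuclideanSpace ℝ (Fin 3) → EuclideanSpace ℝ (Fin 3)}
    (hL2 : Integrable fun y => ‖w y‖ ^ 2) {g : EuclideanSpace ℝ (Fin 3) → ℝ} (hg : Continuous g)
    {M : ℝ} (hM : ∀ x, |g x| ≤ M) : Integrable fun y => ‖w y‖ ^ 2 * g y := by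
  refine (hL2.mul_const M).mono' (hL2.aestronglyMeasurable.mul hg.aestronglyMeasurable)
    (Eventually.of_forall fun x => ?_)
  rw [Real.norm_eq_abs, abs_mul, abs_of_nonneg (sq_nonneg _)]
  exact mul_le_mul_of_nonneg_left (hM x) (sq_nonneg _)

/-- **The truncation only removes energy**: `F_L(r) ≤ F(r)`, i.e.
`0 ≤ ∫ |w|² r⁻¹P̄ − ∫ (r⁻¹ P̄ X) |w|²` (`0 ≤ X ≤ 1`). [folklore] -/
theorem probeEnergy_sub_truncated_nonneg (hPb : ContDiff ℝ ∞ Pb) (hPbnn : ∀ σ, 0 ≤ Pb σ)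
    (hPble : ∀ σ, Pb σ ≤ 1) {L r : ℝ} (hL : 1 ≤ L) (hr : 0 < r)
    {w : EuclideanSpace ℝ (Fin 3) → EuclideanSpace ℝ (Fin 3)}
    (hL2 : Integrable fun y => ‖w y‖ ^ 2) (x₀ : EuclideanSpace ℝ (Fin 3)) :
    0 ≤ (∫ x, ‖w x‖ ^ 2 * (r⁻¹ * Pb (‖x - x₀‖ ^ 2 / r ^ 2))) -
      ∫ x, r⁻¹ * (Pb (‖x - x₀‖ ^ 2 / r ^ 2) * cutoffProfile 1 2 (‖x - x₀‖ ^ 2 / r ^ 2 / L ^ 2)) *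
        ‖w x‖ ^ 2 := by
  have _ := hL
  have hn : Continuous fun x : EuclideanSpace ℝ (Fin 3) => ‖x - x₀‖ ^ 2 / r ^ 2 :=
    ((continuous_id.sub continuous_const).norm.pow 2).div_const _
  have c1 : Continuous fun x : EuclideanSpace ℝ (Fin 3) => r⁻¹ * Pb (‖x - x₀‖ ^ 2 / r ^ 2) :=
    continuous_const.mul (hPb.continuous.comp hn)
  have c2 : Continuous fun x : EuclideanSpace ℝ (Fin 3) =>
      r⁻¹ * (Pb (‖x - x₀‖ ^ 2 / r ^ 2) * cutoffProfile 1 2 (‖x - x₀‖ ^ 2 / r ^ 2 / L ^ 2)) :=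
    continuous_const.mul ((hPb.continuous.comp hn).mul
      ((cutoffProfile_contDiff 1 2 (n := 0)).continuous.comp (hn.div_const _)))
  have b1 : ∀ x : EuclideanSpace ℝ (Fin 3), |r⁻¹ * Pb (‖x - x₀‖ ^ 2 / r ^ 2)| ≤ r⁻¹ := fun x => by
    rw [abs_mul, abs_of_pos (inv_pos.2 hr), abs_of_nonneg (hPbnn _)]
    exact mul_le_of_le_one_right (inv_pos.2 hr).le (hPble _)
  have b2 : ∀ x : EuclideanSpace ℝ (Fin 3),
      |r⁻¹ * (Pb (‖x - x₀‖ ^ 2 / r ^ 2) * cutoffProfile 1 2 (‖x - x₀‖ ^ 2 / r ^ 2 / L ^ 2))| ≤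
        r⁻¹ := fun x => by
    rw [abs_mul, abs_of_pos (inv_pos.2 hr), abs_of_nonneg
      (mul_nonneg (hPbnn _) (cutoffProfile_nonneg _ _ _))]
    exact mul_le_of_le_one_right (inv_pos.2 hr).le
      (mul_le_one₀ (hPble _) (cutoffProfile_nonneg _ _ _) (cutoffProfile_le_one _ _ _))
  have i1 := integrable_norm_sq_mul_of_abs_le hL2 c1 b1
  have i2 := integrable_norm_sq_mul_of_abs_le hL2 c2 b2
  have e2 : ∫ x, r⁻¹ * (Pb (‖x - x₀‖ ^ 2 / r ^ 2) *
      cutoffProfile 1 2 (‖x - x₀‖ ^ 2 / r ^ 2 / L ^ 2)) * ‖w x‖ ^ 2 =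
      ∫ x, ‖w x‖ ^ 2 * (r⁻¹ * (Pb (‖x - x₀‖ ^ 2 / r ^ 2) *
        cutoffProfile 1 2 (‖x - x₀‖ ^ 2 / r ^ 2 / L ^ 2))) :=
    integral_congr_ae (Eventually.of_forall fun x => by ring)
  rw [e2, ← integral_sub i1 i2]
  refine integral_nonneg fun x => ?_
  show 0 ≤ ‖w x‖ ^ 2 * (r⁻¹ * Pb (‖x - x₀‖ ^ 2 / r ^ 2)) -
    ‖w x‖ ^ 2 * (r⁻¹ * (Pb (‖x - x₀‖ ^ 2 / r ^ 2) *
      cutoffProfile 1 2 (‖x - x₀‖ ^ 2 / r ^ 2 / L ^ 2)))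
  have hX : cutoffProfile 1 2 (‖x - x₀‖ ^ 2 / r ^ 2 / L ^ 2) ≤ 1 := cutoffProfile_le_one _ _ _
  have hPr : 0 ≤ r⁻¹ * Pb (‖x - x₀‖ ^ 2 / r ^ 2) := mul_nonneg (inv_pos.2 hr).le (hPbnn _)
  have : r⁻¹ * (Pb (‖x - x₀‖ ^ 2 / r ^ 2) * cutoffProfile 1 2 (‖x - x₀‖ ^ 2 / r ^ 2 / L ^ 2)) ≤
      r⁻¹ * Pb (‖x - x₀‖ ^ 2 / r ^ 2) := by
    calc r⁻¹ * (Pb (‖x - x₀‖ ^ 2 / r ^ 2) * cutoffProfile 1 2 (‖x - x₀‖ ^ 2 / r ^ 2 / L ^ 2))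
        = (r⁻¹ * Pb (‖x - x₀‖ ^ 2 / r ^ 2)) * cutoffProfile 1 2 (‖x - x₀‖ ^ 2 / r ^ 2 / L ^ 2) := by
          ring
      _ ≤ (r⁻¹ * Pb (‖x - x₀‖ ^ 2 / r ^ 2)) * 1 := mul_le_mul_of_nonneg_left hX hPr
      _ = r⁻¹ * Pb (‖x - x₀‖ ^ 2 / r ^ 2) := mul_one _
  nlinarith [sq_nonneg ‖w x‖]

/-- **The tail of the probe energy**: `F(r) − F_L(r) ≤ L⁻² F(Lr)` for the truncated probe
energy `F_L(r) = ∫ (r⁻¹ P̄(|x - x₀|²/r²) X(|x - x₀|²/r²/L²)) |w|²` of a field of finite energy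
(`X = 1` on `|x - x₀| ≤ Lr`, and beyond the power-law tail scales by `L⁻²`). [folklore] -/
theorem probeEnergy_sub_truncated_le (hP : ContDiff ℝ ∞ P) (hPb : ContDiff ℝ ∞ Pb)
    (hode : ∀ σ, Pb σ + 2 / 3 * σ * deriv Pb σ = P σ) (hP0 : ∀ σ, 1 ≤ σ → P σ = 0)
    (hPbpos : ∀ σ, 0 < Pb σ) (hPble : ∀ σ, Pb σ ≤ 1) {L r : ℝ} (hL : 1 ≤ L) (hr : 0 < r)
    {w : EuclideanSpace ℝ (Fin 3) → EuclideanSpace ℝ (Fin 3)}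
    (hL2 : Integrable fun y => ‖w y‖ ^ 2) (x₀ : EuclideanSpace ℝ (Fin 3)) :
    (∫ x, ‖w x‖ ^ 2 * (r⁻¹ * Pb (‖x - x₀‖ ^ 2 / r ^ 2))) -
        ∫ x, r⁻¹ * (Pb (‖x - x₀‖ ^ 2 / r ^ 2) * cutoffProfile 1 2 (‖x - x₀‖ ^ 2 / r ^ 2 / L ^ 2)) *
          ‖w x‖ ^ 2 ≤
      (L ^ 2)⁻¹ * ∫ x, ‖w x‖ ^ 2 * ((L * r)⁻¹ * Pb (‖x - x₀‖ ^ 2 / (L * r) ^ 2)) := by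
  have _ := hP
  have hPbnn : ∀ σ, 0 ≤ Pb σ := fun σ => (hPbpos σ).le
  have hL0 : 0 < L := by linarith
  have hLr : 0 < L * r := mul_pos hL0 hr
  have hPbd : Differentiable ℝ Pb := hPb.differentiable (by simp)
  have hn : ∀ s : ℝ, Continuous fun x : EuclideanSpace ℝ (Fin 3) => ‖x - x₀‖ ^ 2 / s ^ 2 := fun s =>
    ((continuous_id.sub continuous_const).norm.pow 2).div_const _
  have c1 : Continuous fun x : EuclideanSpace ℝ (Fin 3) => r⁻¹ * Pb (‖x - x₀‖ ^ 2 / r ^ 2) :=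
    continuous_const.mul (hPb.continuous.comp (hn r))
  have c2 : Continuous fun x : EuclideanSpace ℝ (Fin 3) =>
      r⁻¹ * (Pb (‖x - x₀‖ ^ 2 / r ^ 2) * cutoffProfile 1 2 (‖x - x₀‖ ^ 2 / r ^ 2 / L ^ 2)) :=
    continuous_const.mul ((hPb.continuous.comp (hn r)).mul
      ((cutoffProfile_contDiff 1 2 (n := 0)).continuous.comp ((hn r).div_const _)))
  have c3 : Continuous fun x : EuclideanSpace ℝ (Fin 3) =>
      (L ^ 2)⁻¹ * ((L * r)⁻¹ * Pb (‖x - x₀‖ ^ 2 / (L * r) ^ 2)) :=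
    continuous_const.mul (continuous_const.mul (hPb.continuous.comp (hn (L * r))))
  have b1 : ∀ x : EuclideanSpace ℝ (Fin 3), |r⁻¹ * Pb (‖x - x₀‖ ^ 2 / r ^ 2)| ≤ r⁻¹ := fun x => by
    rw [abs_mul, abs_of_pos (inv_pos.2 hr), abs_of_nonneg (hPbnn _)]
    exact mul_le_of_le_one_right (inv_pos.2 hr).le (hPble _)
  have b2 : ∀ x : EuclideanSpace ℝ (Fin 3),
      |r⁻¹ * (Pb (‖x - x₀‖ ^ 2 / r ^ 2) * cutoffProfile 1 2 (‖x - x₀‖ ^ 2 / r ^ 2 / L ^ 2))| ≤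
        r⁻¹ := fun x => by
    rw [abs_mul, abs_of_pos (inv_pos.2 hr), abs_of_nonneg
      (mul_nonneg (hPbnn _) (cutoffProfile_nonneg _ _ _))]
    exact mul_le_of_le_one_right (inv_pos.2 hr).le
      (mul_le_one₀ (hPble _) (cutoffProfile_nonneg _ _ _) (cutoffProfile_le_one _ _ _))
  have b3 : ∀ x : EuclideanSpace ℝ (Fin 3),
      |(L ^ 2)⁻¹ * ((L * r)⁻¹ * Pb (‖x - x₀‖ ^ 2 / (L * r) ^ 2))| ≤ (L ^ 2)⁻¹ * (L * r)⁻¹ :=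
    fun x => by
    rw [abs_mul, abs_mul, abs_of_pos (inv_pos.2 (by positivity)), abs_of_pos (inv_pos.2 hLr),
      abs_of_nonneg (hPbnn _), ← mul_assoc]
    exact mul_le_of_le_one_right (by positivity) (hPble _)
  have i1 := integrable_norm_sq_mul_of_abs_le hL2 c1 b1
  have i2 := integrable_norm_sq_mul_of_abs_le hL2 c2 b2
  have i3 := integrable_norm_sq_mul_of_abs_le hL2 c3 b3
  have e2 : ∫ x, r⁻¹ * (Pb (‖x - x₀‖ ^ 2 / r ^ 2) *
      cutoffProfile 1 2 (‖x - x₀‖ ^ 2 / r ^ 2 / L ^ 2)) * ‖w x‖ ^ 2 =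
      ∫ x, ‖w x‖ ^ 2 * (r⁻¹ * (Pb (‖x - x₀‖ ^ 2 / r ^ 2) *
        cutoffProfile 1 2 (‖x - x₀‖ ^ 2 / r ^ 2 / L ^ 2))) :=
    integral_congr_ae (Eventually.of_forall fun x => by ring)
  have e3 : (L ^ 2)⁻¹ * ∫ x, ‖w x‖ ^ 2 * ((L * r)⁻¹ * Pb (‖x - x₀‖ ^ 2 / (L * r) ^ 2)) =
      ∫ x, ‖w x‖ ^ 2 * ((L ^ 2)⁻¹ * ((L * r)⁻¹ * Pb (‖x - x₀‖ ^ 2 / (L * r) ^ 2))) := by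
    rw [← integral_const_mul]
    exact integral_congr_ae (Eventually.of_forall fun x => by ring)
  rw [e2, e3, ← integral_sub i1 i2]
  refine integral_mono (i1.sub i2) i3 fun x => ?_
  have hX1 : ∀ τ, τ ≤ 1 → cutoffProfile 1 2 τ = 1 := fun τ hτ =>
    cutoffProfile_eq_one zero_le_one one_lt_two (by simpa using hτ)
  show ‖w x‖ ^ 2 * (r⁻¹ * Pb (‖x - x₀‖ ^ 2 / r ^ 2)) -
      ‖w x‖ ^ 2 * (r⁻¹ * (Pb (‖x - x₀‖ ^ 2 / r ^ 2) *
        cutoffProfile 1 2 (‖x - x₀‖ ^ 2 / r ^ 2 / L ^ 2))) ≤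
    ‖w x‖ ^ 2 * ((L ^ 2)⁻¹ * ((L * r)⁻¹ * Pb (‖x - x₀‖ ^ 2 / (L * r) ^ 2)))
  by_cases hx : ‖x - x₀‖ ≤ L * r
  · -- inside: the truncation is inactive and the difference vanishes
    have hτ : ‖x - x₀‖ ^ 2 / r ^ 2 / L ^ 2 ≤ 1 := by
      rw [div_le_one (by positivity), div_le_iff₀ (by positivity)]
      nlinarith [hx, norm_nonneg (x - x₀), hLr]
    rw [hX1 _ hτ, mul_one, sub_self]
    exact mul_nonneg (sq_nonneg _) (mul_nonneg (by positivity)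
      (mul_nonneg (inv_pos.2 hLr).le (hPbnn _)))
  · -- outside: drop the truncated part and use the power-law scaling
    have hy : L * r ≤ ‖x - x₀‖ := (not_le.1 hx).le
    have hscale := inv_mul_probe_eq_of_le hPbd hode hP0 hPbpos hL hr hy
    have hdrop : ‖w x‖ ^ 2 * (r⁻¹ * Pb (‖x - x₀‖ ^ 2 / r ^ 2)) -
        ‖w x‖ ^ 2 * (r⁻¹ * (Pb (‖x - x₀‖ ^ 2 / r ^ 2) *
          cutoffProfile 1 2 (‖x - x₀‖ ^ 2 / r ^ 2 / L ^ 2))) ≤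
        ‖w x‖ ^ 2 * (r⁻¹ * Pb (‖x - x₀‖ ^ 2 / r ^ 2)) := by
      have : 0 ≤ ‖w x‖ ^ 2 * (r⁻¹ * (Pb (‖x - x₀‖ ^ 2 / r ^ 2) *
          cutoffProfile 1 2 (‖x - x₀‖ ^ 2 / r ^ 2 / L ^ 2))) :=
        mul_nonneg (sq_nonneg _) (mul_nonneg (inv_pos.2 hr).le
          (mul_nonneg (hPbnn _) (cutoffProfile_nonneg _ _ _)))
      linarith
    exact hdrop.trans_eq (by rw [hscale])

/-! ### The probe energy of a classical solution over a window -/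

/-- **The probe energy cannot jump up over a window.** For a probe pair with `P̄ > 0` and
`L ≥ 1` there is `C = C(P̄, L) ≥ 0` such that: for every classical solution of the unforced
Navier–Stokes system (`ν ≥ 0`) on an open time set `S` with slices of finite energy, every
centre `x₀`, scale `r > 0`, window `t₀ ≤ t₁`, `[t₀, t₁] ⊆ S`, gauge `c`, and bounds
`∫_{B(x₀,3Lr)} |u(t)|² ≤ a` on `[t₀, t₁]`, `∬_W |u|³ ≤ m₃`, `∬_W |p − c(t)| |u| ≤ m_{pu}`
(integrable) on `W = (t₀, t₁) × B(x₀, 3Lr)`: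
`F(r; x₀, t₁) − F(r; x₀, t₀) ≤ L⁻² F(Lr; x₀, t₁) + ν (C/r³) a (t₁ − t₀) + (C/r²) m₃ + 2 (C/r²) m_{pu}`.
[cite: CaffarelliKohnNirenberg1982, §2 (2.5)] -/
theorem probeEnergy_sub_le_window (hP : ContDiff ℝ ∞ P) (hPb : ContDiff ℝ ∞ Pb)
    (hode : ∀ σ, Pb σ + 2 / 3 * σ * deriv Pb σ = P σ) (hP0 : ∀ σ, 1 ≤ σ → P σ = 0)
    (hPbpos : ∀ σ, 0 < Pb σ) (hPble : ∀ σ, Pb σ ≤ 1) (hPb1 : ∀ σ, σ ≤ 1 / 4 → Pb σ = 1)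
    {L : ℝ} (hL : 1 ≤ L) :
    ∃ C : ℝ, 0 ≤ C ∧
    ∀ {S : Set ℝ} {ν : ℝ} {u : ℝ → EuclideanSpace ℝ (Fin 3) → EuclideanSpace ℝ (Fin 3)}
      {p : ℝ → EuclideanSpace ℝ (Fin 3) → ℝ},
      IsClassicalNSSolutionOn S ν 0 u p → IsOpen S → 0 ≤ ν →
    ∀ (x₀ : EuclideanSpace ℝ (Fin 3)) {r : ℝ}, 0 < r →
    ∀ {t₀ t₁ : ℝ}, t₀ ≤ t₁ → Icc t₀ t₁ ⊆ S →
      (∀ s ∈ Icc t₀ t₁, Integrable fun y => ‖u s y‖ ^ 2) →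
    ∀ {a : ℝ}, (∀ s ∈ Icc t₀ t₁, ∫ x in ball x₀ (3 * L * r), ‖u s x‖ ^ 2 ≤ a) →
    ∀ {c : ℝ → ℝ} {m₃ mpu : ℝ},
      (∫ z in Ioo t₀ t₁ ×ˢ ball x₀ (3 * L * r), ‖u z.1 z.2‖ ^ 3 ≤ m₃) →
      IntegrableOn (fun z : ℝ × EuclideanSpace ℝ (Fin 3) => |p z.1 z.2 - c z.1| * ‖u z.1 z.2‖)
        (Ioo t₀ t₁ ×ˢ ball x₀ (3 * L * r)) →
      (∫ z in Ioo t₀ t₁ ×ˢ ball x₀ (3 * L * r), |p z.1 z.2 - c z.1| * ‖u z.1 z.2‖ ≤ mpu) →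
      (∫ x, ‖u t₁ x‖ ^ 2 * (r⁻¹ * Pb (‖x - x₀‖ ^ 2 / r ^ 2))) -
          (∫ x, ‖u t₀ x‖ ^ 2 * (r⁻¹ * Pb (‖x - x₀‖ ^ 2 / r ^ 2))) ≤
        (L ^ 2)⁻¹ * (∫ x, ‖u t₁ x‖ ^ 2 * ((L * r)⁻¹ * Pb (‖x - x₀‖ ^ 2 / (L * r) ^ 2))) +
          (ν * (C / r ^ 3) * a * (t₁ - t₀) + C / r ^ 2 * m₃ + 2 * (C / r ^ 2) * mpu) := by
  have hPbnn : ∀ σ, 0 ≤ Pb σ := fun σ => (hPbpos σ).le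
  obtain ⟨C, hC0, hC⟩ := exists_probeCutoff_bounds hPb hPbnn hPble hPb1 hL
  refine ⟨C, hC0, ?_⟩
  intro S ν u p h hS hν x₀ r hr t₀ t₁ ht₀₁ hI hfin a ha c m₃ mpu h3 hq hpu
  have hL0 : 0 < L := by linarith
  obtain ⟨hφs, hφc, hφ0, -, hts, -, hD, hΔ⟩ := hC r hr x₀
  -- the window bound for the truncated probe energy, on the ball of radius `3Lr`
  have hsupp : tsupport (fun x : EuclideanSpace ℝ (Fin 3) =>
      r⁻¹ * (Pb (‖x - x₀‖ ^ 2 / r ^ 2) * cutoffProfile 1 2 (‖x - x₀‖ ^ 2 / r ^ 2 / L ^ 2))) ⊆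
      ball x₀ (3 * L * r) :=
    hts.trans (closedBall_subset_ball (by nlinarith [mul_pos hL0 hr]))
  have hwin := h.integral_cutoff_norm_sq_sub_le_window hS hν hφs hφc hφ0 hsupp hD hΔ
    (by positivity) ht₀₁ hI ha h3 hq hpu
  -- the tail at `t₁` and the truncation at `t₀`
  have htail := probeEnergy_sub_truncated_le hP hPb hode hP0 hPbpos hPble hL hr
    (hfin t₁ (right_mem_Icc.2 ht₀₁)) x₀
  have hnn := probeEnergy_sub_truncated_nonneg hPb hPbnn hPble hL hr
    (hfin t₀ (left_mem_Icc.2 ht₀₁)) x₀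
  linarith

/-! ### From "large at times arbitrarily close to `T`" to "large on a final window" -/

/-- **Frequent largeness plus no upward jumps on short windows gives largeness on a final
window.** If `g(t) > δ` at times `t < T` arbitrarily close to `T`, and `g(t₀) ≥ g(t₁) − ε`
whenever `T − η < t₀ ≤ t₁ < T` and `t₁ − t₀ ≤ τ`, then `g ≥ δ − ε` on `(T − min(η, τ), T)`.
[folklore] -/
theorem le_of_frequently_gt_of_window {g : ℝ → ℝ} {T δ ε η τ : ℝ}
    (hfreq : ∀ t' < T, ∃ t ∈ Ioo t' T, δ < g t)
    (hwin : ∀ t₀ t₁, T - η < t₀ → t₀ ≤ t₁ → t₁ < T → t₁ - t₀ ≤ τ → g t₁ - ε ≤ g t₀) :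
    ∀ t ∈ Ioo (T - min η τ) T, δ - ε ≤ g t := by
  intro t ht
  obtain ⟨t₁, ht₁, hgt₁⟩ := hfreq t ht.2
  have h1 : T - η < t := lt_of_le_of_lt (by linarith [min_le_left η τ]) ht.1
  have h2 : t₁ - t ≤ τ := by
    have : T - τ ≤ T - min η τ := by linarith [min_le_right η τ]
    linarith [ht.1, ht₁.2]
  have := hwin t t₁ h1 ht₁.1.le ht₁.2 h2
  linarith

end SereginSverak2002

end Literature.Analysis.FluidPDE

end
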